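import Summits.FinalStateConjecture.FinalStateConjecture.Theorems.SwallowTheDatumParametricKerrBurialStubFarGluingOfUnitGluing
import Summits.FinalStateConjecture.FinalStateConjecture.Theorems.SwallowTheDatumKerrShieldedDataExistStubIsotropicEnd
import Literature.Geometry.Lorentzian.DilationDecay
import HarnessLib

/-!
# Route `ExactKerrEnds`, crux `TameEscapeToKerrEnds` (stmt-FinalStateConjecture-18522), line
# `matched-kerr-solution-map`: unit-scale bookkeeping for the curve-indexed analytic stub (part 1)

Plumbing for the reduction of the curve-indexed matched Kerr gluing S1♭ (file
`ExactKerrEndsTameEscapeToKerrEndsGluingCurve.lean`) to a statement about data on `ℝ³` at UNIT scale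
(part 2, `ExactKerrEndsTameEscapeToKerrEndsUnitCurve.lean`): along a curve `s ↦ (R s, O s)` of gluing
radii `R s` and unit-scale outputs `O s` (data on `ℝ³`, meaningful on `{1 < ‖y‖}`), the glued datum on
`X` is `d` inside and `coord^*((O s).dilate (R s))` beyond chart radius `5 R s / 4` (the far patch of the
sibling crux `SwallowTheDatum.ParametricKerrBurial`, stub `stub_farGluing_of_unitGluing`).  Here:

* `exists_identityEnd_one` — the tautological end of `ℝ³` beyond radius `1` (identity chart): sole, and
  its chart components are the values of the tensors;
* `isStronglyAsymptoticallyFlatDR_of_coordDecay` — Dafermos–Rodnianski decay stated on the Cartesian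
  components `coordH`, `coordK` gives DR decay along that end; `isStronglyAsymptoticallyFlatDR_dilate_of`
  — and along the same end the dilate `C.dilate l` is DR with mass `l μ`;
* `contMDiffOn_rescaledCurve` — joint smoothness of `(s, z) ↦ h_{O s}(z / R s)`, `(R s)⁻¹ k_{O s}(z / R s)`
  for a smooth radius FUNCTION `R` (the sibling's `contMDiffOn_rescaledFamily` is the case `R = id`);
* `smoothSectionsOn_of_farPatchCurve` — joint smoothness on `{s⋆ < s} × X` of a family of sections which
  is an outer family beyond `e.far (5 R s / 4)` and a fixed smooth section inside `e.closedFar (7 R s / 4)`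
  (the sibling's `smoothSectionsOn_of_farPatchFamily` for a continuous radius function).

References: Corvino 2000, §4; Bartnik 1986, §1; Bartnik–Isenberg 2004, §2; Dafermos–Rodnianski 2013,
App. B.2.3.  Everything is proved; no definitions, no named facts.
-/

set_option linter.dupNamespace false
-- instance search through the nested operator type `E3 →L[ℝ] E3 →L[ℝ] ℝ` (as in the sibling files)
set_option maxSynthPendingDepth 3

noncomputable section

namespace Summit.FinalStateConjecture.FinalStateConjecture.Theorems.ExactKerrEnds

open scoped Manifold ContDiff Topology
open Set Filter Function Metric Bornology Asymptotics Literature.Geometry.Lorentzian Literature.Geometry.Manifold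
open Summit.FinalStateConjecture.FinalStateConjecture.Theorems.SwallowTheDatum
  (isSoleEnd_of_chart_id hCoeff_apply_of_dataChart_eq kCoeff_apply_of_dataChart_eq
    isClosed_image_val_preimage_refl)
open Summit.FinalStateConjecture.FinalStateConjecture.Theorems.SwallowTheDatum.ParametricKerrBurial
  (SmoothSectionsOn contMDiffOn_coord_of_smoothSectionsOn)

/-! ## §1 The tautological end of `ℝ³` beyond radius `1` -/

/-- **The tautological end of `ℝ³` beyond radius `1`** (`U = exteriorRegion 1`, identity chart): it is
the sole end of `ℝ³`, its chart radius is `1`, and its chart components are the values of the tensors,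
`hCoeff f C x = h_C(x)`, `kCoeff f C x = k_C(x)` for `1 < ‖x‖`. Bartnik 1986, §1 and Def. 2.1.
[cite: Bartnik1986, §1] -/
theorem exists_identityEnd_one :
    ∃ f : AFEnd E3, f.IsSoleEnd ∧ f.R = 1 ∧
      ∀ (C : InitialDataSet (𝓡 3) E3) (x : E3), 1 < ‖x‖ →
        AFEnd.hCoeff f C x = C.coordH x ∧ AFEnd.kCoeff f C x = C.coordK x := by
  let f : AFEnd E3 := ⟨exteriorRegion 1, 1, one_pos, Diffeomorph.refl (𝓡 3) (exteriorRegion 1) ∞,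
    fun R' hR' ↦ isClosed_image_val_preimage_refl hR'⟩
  refine ⟨f, isSoleEnd_of_chart_id f (fun _ ↦ rfl) (fun _ h ↦ h), rfl, fun C x hx ↦ ⟨?_, ?_⟩⟩
  · ext v w
    exact hCoeff_apply_of_dataChart_eq f (fun _ ↦ rfl) C hx v w
  · ext v w
    exact kCoeff_apply_of_dataChart_eq f (fun _ ↦ rfl) C hx v w

/-- **Dafermos–Rodnianski decay read on the Cartesian components.** On an end `f` of `ℝ³` with chart
radius `1` whose chart components are the values of the tensors, the decay
`h_C − (1 + 2μ/r) δ = o₂(r⁻¹)`, `k_C = o₁(r⁻²)` of the Cartesian components `coordH`, `coordK` is DR decay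
of `C` along `f` with mass `μ` (the two readings agree on the open set `{1 < ‖y‖}`, so do their iterated
derivatives). Dafermos–Rodnianski 2013, App. B.2.3. [cite: DafermosRodnianski2013, App. B.2.3] -/
theorem isStronglyAsymptoticallyFlatDR_of_coordDecay {f : AFEnd E3}
    (hf : ∀ (C : InitialDataSet (𝓡 3) E3) (x : E3), 1 < ‖x‖ →
      AFEnd.hCoeff f C x = C.coordH x ∧ AFEnd.kCoeff f C x = C.coordK x)
    (C : InitialDataSet (𝓡 3) E3) (μ : ℝ)
    (hh : ∀ m : ℕ, m ≤ 2 →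
      (fun y ↦ ‖iteratedFDeriv ℝ m
          (fun y ↦ C.coordH y - (1 + 2 * μ / ‖y‖) • (innerSL ℝ : E3 →L[ℝ] E3 →L[ℝ] ℝ)) y‖)
        =o[cobounded E3] fun y ↦ ‖y‖ ^ (-1 - m : ℝ))
    (hk : ∀ m : ℕ, m ≤ 1 →
      (fun y ↦ ‖iteratedFDeriv ℝ m C.coordK y‖) =o[cobounded E3] fun y ↦ ‖y‖ ^ (-2 - m : ℝ)) :
    f.IsStronglyAsymptoticallyFlatDR C μ := by
  have hset : ∀ᶠ y : E3 in cobounded E3, 1 < ‖y‖ := by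
    filter_upwards [eventually_cobounded_le_norm (E := E3) 2] with y hy
    linarith
  refine ⟨fun m hm ↦ (hh m hm).congr' ?_ EventuallyEq.rfl, fun m hm ↦ (hk m hm).congr' ?_ EventuallyEq.rfl⟩
  · filter_upwards [hset] with y hy
    have hev : (fun y ↦ C.coordH y - (1 + 2 * μ / ‖y‖) • (innerSL ℝ : E3 →L[ℝ] E3 →L[ℝ] ℝ)) =ᶠ[𝓝 y]
        fun y ↦ AFEnd.hCoeff f C y - (1 + 2 * μ / ‖y‖) • (innerSL ℝ : E3 →L[ℝ] E3 →L[ℝ] ℝ) := by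
      filter_upwards [(isOpen_lt continuous_const continuous_norm).mem_nhds hy] with z hz
      rw [(hf C z hz).1]
    rw [(hev.iteratedFDeriv ℝ m).eq_of_nhds]
  · filter_upwards [hset] with y hy
    have hev : C.coordK =ᶠ[𝓝 y] AFEnd.kCoeff f C := by
      filter_upwards [(isOpen_lt continuous_const continuous_norm).mem_nhds hy] with z hz
      rw [(hf C z hz).2]
    rw [(hev.iteratedFDeriv ℝ m).eq_of_nhds]

/-- **The dilate of a DR datum on `ℝ³` is DR along the same tautological end, with mass `l μ`** (`l ≥ 1`):
`hCoeff f (C.dilate l) ζ = h_C(ζ/l) = hCoeff f C (ζ/l)` and `kCoeff f (C.dilate l) ζ = l⁻¹ kCoeff f C (ζ/l)`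
for `l < ‖ζ‖` (`coordH_dilate`, `coordK_dilate`), and the decay classes transfer under dilation of the
chart (`IsStronglyAsymptoticallyFlatDR.of_coeff_dilation`). Bartnik 1986, §1 (mass scales like a length).
[cite: DafermosRodnianski2013, App. B.2.3] -/
theorem isStronglyAsymptoticallyFlatDR_dilate_of {f : AFEnd E3}
    (hf : ∀ (C : InitialDataSet (𝓡 3) E3) (x : E3), 1 < ‖x‖ →
      AFEnd.hCoeff f C x = C.coordH x ∧ AFEnd.kCoeff f C x = C.coordK x)
    {C : InitialDataSet (𝓡 3) E3} {μ : ℝ} (hC : f.IsStronglyAsymptoticallyFlatDR C μ) {l : ℝ}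
    (hl : 1 ≤ l) :
    f.IsStronglyAsymptoticallyFlatDR (C.dilate l (by linarith)) (l * μ) := by
  have hl0 : 0 < l := by linarith
  have hnorm : ∀ ζ : E3, ‖l⁻¹ • ζ‖ = l⁻¹ * ‖ζ‖ := fun ζ ↦ by
    rw [norm_smul, norm_inv, Real.norm_of_nonneg hl0.le]
  have hin : ∀ ζ : E3, l < ‖ζ‖ → 1 < ‖l⁻¹ • ζ‖ := fun ζ hζ ↦ by
    rw [hnorm, lt_inv_mul_iff₀ hl0, mul_one]; exact hζ
  refine AFEnd.IsStronglyAsymptoticallyFlatDR.of_coeff_dilation (R₀ := l) hl0 (fun ζ hζ ↦ ?_)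
    (fun ζ hζ ↦ ?_) hC
  · rw [(hf _ ζ (by linarith)).1, (hf C _ (hin ζ hζ)).1]
    exact C.coordH_dilate l hl0 ζ
  · rw [(hf _ ζ (by linarith)).2, (hf C _ (hin ζ hζ)).2]
    exact C.coordK_dilate l hl0 ζ

/-! ## §2 Joint smoothness of the rescaled fields along a curve of radii -/

variable {X : Type} [TopologicalSpace X] [ChartedSpace E3 X] [IsManifold (𝓡 3) ∞ X]

/-- **Joint smoothness of the Cartesian components of the dilates `(O s).dilate (R s)`** along a curve:
for outputs `O s` with sections jointly smooth on `{s⋆ < s} × {1 < ‖y‖}` and a smooth radius function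
`R ≥ 1` on `(s⋆, ∞)`, the maps `(s, z) ↦ h_{O s}(z / R s)` and `(s, z) ↦ (R s)⁻¹ k_{O s}(z / R s)` are smooth
on `{s⋆ < s} × {R s < ‖z‖}` (composition with the smooth `(s, z) ↦ (s, z / R s)`). [folklore] -/
theorem contMDiffOn_rescaledCurve {O : ℝ → InitialDataSet (𝓡 3) E3} {sstar : ℝ} {R : ℝ → ℝ}
    (hRd : ContDiff ℝ ∞ R) (hR1 : ∀ s, sstar < s → 1 ≤ R s)
    (hO : SmoothSectionsOn 𝓘(ℝ, ℝ) O {p : ℝ × E3 | sstar < p.1 ∧ 1 < ‖p.2‖}) :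
    ContMDiffOn (𝓘(ℝ, ℝ).prod 𝓘(ℝ, E3)) 𝓘(ℝ, E3 →L[ℝ] E3 →L[ℝ] ℝ) ∞
        (fun p : ℝ × E3 ↦ (O p.1).coordH ((R p.1)⁻¹ • p.2)) {p : ℝ × E3 | sstar < p.1 ∧ R p.1 < ‖p.2‖} ∧
      ContMDiffOn (𝓘(ℝ, ℝ).prod 𝓘(ℝ, E3)) 𝓘(ℝ, E3 →L[ℝ] E3 →L[ℝ] ℝ) ∞
        (fun p : ℝ × E3 ↦ (R p.1)⁻¹ • (O p.1).coordK ((R p.1)⁻¹ • p.2))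
        {p : ℝ × E3 | sstar < p.1 ∧ R p.1 < ‖p.2‖} := by
  have hopen : IsOpen {p : ℝ × E3 | sstar < p.1 ∧ 1 < ‖p.2‖} :=
    (isOpen_lt continuous_const continuous_fst).inter
      (isOpen_lt continuous_const (continuous_norm.comp continuous_snd))
  obtain ⟨hH, hK⟩ := contMDiffOn_coord_of_smoothSectionsOn hopen hO
  have hpos : ∀ p ∈ {p : ℝ × E3 | sstar < p.1 ∧ R p.1 < ‖p.2‖}, 0 < R p.1 := fun p hp ↦ by
    linarith [hR1 p.1 hp.1]
  have hRm : ContMDiff 𝓘(ℝ, ℝ) 𝓘(ℝ, ℝ) ∞ R := hRd.contMDiff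
  have hpair : ∀ p : ℝ × E3, ContMDiffAt (𝓘(ℝ, ℝ).prod 𝓘(ℝ, E3)) (𝓘(ℝ, ℝ).prod 𝓘(ℝ, E3)) ∞
      (fun q : ℝ × E3 ↦ (R q.1, q.2)) p := fun p ↦
    (hRm.contMDiffAt.comp p contMDiffAt_fst).prodMk contMDiffAt_snd
  have hshrink : ∀ p ∈ {p : ℝ × E3 | sstar < p.1 ∧ R p.1 < ‖p.2‖},
      ContMDiffAt (𝓘(ℝ, ℝ).prod 𝓘(ℝ, E3)) 𝓘(ℝ, E3) ∞ (fun q : ℝ × E3 ↦ (R q.1)⁻¹ • q.2) p := by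
    intro p hp
    have h := InitialDataSet.contMDiffAt_shrink_uncurry (p := (R p.1, p.2)) (hpos p hp).ne'
    exact (h.comp p (hpair p) :)
  have hφ : ContMDiffOn (𝓘(ℝ, ℝ).prod 𝓘(ℝ, E3)) (𝓘(ℝ, ℝ).prod 𝓘(ℝ, E3)) ∞
      (fun p : ℝ × E3 ↦ (p.1, (R p.1)⁻¹ • p.2)) {p : ℝ × E3 | sstar < p.1 ∧ R p.1 < ‖p.2‖} := fun p hp ↦
    (contMDiffAt_fst.prodMk (hshrink p hp)).contMDiffWithinAt
  have hmaps : MapsTo (fun p : ℝ × E3 ↦ (p.1, (R p.1)⁻¹ • p.2)) {p : ℝ × E3 | sstar < p.1 ∧ R p.1 < ‖p.2‖}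
      {p : ℝ × E3 | sstar < p.1 ∧ 1 < ‖p.2‖} := by
    intro p hp
    refine ⟨hp.1, ?_⟩
    show 1 < ‖(R p.1)⁻¹ • p.2‖
    rw [norm_smul, norm_inv, Real.norm_of_nonneg (hpos p hp).le, lt_inv_mul_iff₀ (hpos p hp),
      mul_one]
    exact hp.2
  have hinv : ContMDiffOn (𝓘(ℝ, ℝ).prod 𝓘(ℝ, E3)) 𝓘(ℝ, ℝ) ∞ (fun p : ℝ × E3 ↦ (R p.1)⁻¹)
      {p : ℝ × E3 | sstar < p.1 ∧ R p.1 < ‖p.2‖} := fun p hp ↦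
    ((contDiffAt_inv ℝ (hpos p hp).ne').contMDiffAt.comp p
      (hRm.contMDiffAt.comp p contMDiffAt_fst)).contMDiffWithinAt
  exact ⟨hH.comp hφ hmaps, hinv.smul (hK.comp hφ hmaps)⟩

/-! ## §3 Joint smoothness of far-patch families along a curve of radii -/

/-- **Joint smoothness of a far-patch family along a curve of radii.** Let `secP (s, x)` be a family of
bilinear forms on `T_x X`, `s > s⋆`, and `R` a continuous radius function with `R s > max(e.R, 1)`;
suppose that on `e.far (5 R s / 4)` the section `secP (s, ·)` is the outer field `coord^*(fld s)` of a
matrix-valued map `fld` jointly smooth on `{s⋆ < s} × {R s < ‖z‖}`, and that off `e.closedFar (7 R s / 4)`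
it is a fixed smooth section `secD`. Then `(s, x) ↦ secP (s, x)` is a jointly smooth section on
`{s⋆ < s} × X`: near `(s, x)` with `‖coord x‖ ≥ 3 R s / 2` it is the outer family on the product
neighbourhood `{|R s' − R s| < R s / 8} × e.far (45 R s / 32)` (`AFEnd.contMDiffAt_outerField_family`), and
near `(s, x)` with `x ∉ e.closedFar (3 R s / 2)` it is `secD` on `{|R s' − R s| < R s / 8} × (e.closedFar
(3 R s / 2))ᶜ` (the sibling's `smoothSectionsOn_of_farPatchFamily` is the case `R = id`).
[cite: Corvino2000, §4] -/
theorem smoothSectionsOn_of_farPatchCurve {e : AFEnd X} {sstar : ℝ} {R : ℝ → ℝ} (hRc : Continuous R)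
    (hR : ∀ s, sstar < s → max e.R 1 < R s)
    (secP : Π q : ℝ × X, TangentSpace (𝓡 3) q.2 →L[ℝ] TangentSpace (𝓡 3) q.2 →L[ℝ] ℝ)
    (secD : Π x : X, TangentSpace (𝓡 3) x →L[ℝ] TangentSpace (𝓡 3) x →L[ℝ] ℝ)
    (fld : ℝ → E3 → E3 →L[ℝ] E3 →L[ℝ] ℝ)
    (hsecD : ContMDiff (𝓡 3) ((𝓡 3).prod 𝓘(ℝ, E3 →L[ℝ] E3 →L[ℝ] ℝ)) ∞
      (fun x : X ↦ Bundle.TotalSpace.mk' (E3 →L[ℝ] E3 →L[ℝ] ℝ)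
        (E := fun x : X ↦ TangentSpace (𝓡 3) x →L[ℝ] TangentSpace (𝓡 3) x →L[ℝ] ℝ) x (secD x)))
    (hfld : ContMDiffOn (𝓘(ℝ, ℝ).prod 𝓘(ℝ, E3)) 𝓘(ℝ, E3 →L[ℝ] E3 →L[ℝ] ℝ) ∞
      (fun p : ℝ × E3 ↦ fld p.1 p.2) {p : ℝ × E3 | sstar < p.1 ∧ R p.1 < ‖p.2‖})
    (hfar : ∀ q : ℝ × X, sstar < q.1 → q.2 ∈ e.far (5 / 4 * R q.1) →
      secP q = AFEnd.outerField e (fld q.1) q.2)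
    (hin : ∀ q : ℝ × X, sstar < q.1 → q.2 ∉ e.closedFar (7 / 4 * R q.1) → secP q = secD q.2) :
    ContMDiffOn (𝓘(ℝ, ℝ).prod (𝓡 3)) ((𝓡 3).prod 𝓘(ℝ, E3 →L[ℝ] E3 →L[ℝ] ℝ)) ∞
      (fun q : ℝ × X ↦ Bundle.TotalSpace.mk' (E3 →L[ℝ] E3 →L[ℝ] ℝ)
        (E := fun x : X ↦ TangentSpace (𝓡 3) x →L[ℝ] TangentSpace (𝓡 3) x →L[ℝ] ℝ) q.2 (secP q))
      {p : ℝ × X | sstar < p.1} := by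
  rintro ⟨s, x⟩ hq
  have hs : sstar < s := hq
  have hRs := hR s hs
  have hRe : e.R < R s := lt_of_le_of_lt (le_max_left _ _) hRs
  have hR0 : 0 < R s := lt_trans e.R_pos hRe
  apply ContMDiffAt.contMDiffWithinAt
  -- a neighbourhood of `s` on which the radius moves by less than `R s / 8`
  set N : Set ℝ := {s' | |R s' - R s| < R s / 8} ∩ Ioi sstar with hN
  have hNopen : IsOpen N :=
    (isOpen_lt (continuous_abs.comp (hRc.sub continuous_const)) continuous_const).inter isOpen_Ioi
  have hsN : s ∈ N := ⟨by simp [hR0], hs⟩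
  have hNl : ∀ s' ∈ N, |R s' - R s| < R s / 8 := fun s' hs' ↦ hs'.1
  by_cases hx : x ∈ e.closedFar (3 / 2 * R s)
  · -- far out: the outer family on `N × far (45 R s / 32)`
    obtain ⟨hxU, hxρ⟩ := hx
    have hxfar : x ∈ e.far (45 / 32 * R s) := e.mem_far_iff_coord.2 ⟨hxU, by linarith⟩
    have hopen : IsOpen {p : ℝ × E3 | sstar < p.1 ∧ R p.1 < ‖p.2‖} :=
      (isOpen_lt continuous_const continuous_fst).inter
        (isOpen_lt (hRc.comp continuous_fst) (continuous_norm.comp continuous_snd))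
    have hc : ContMDiffAt (𝓘(ℝ, ℝ).prod 𝓘(ℝ, E3)) 𝓘(ℝ, E3 →L[ℝ] E3 →L[ℝ] ℝ) ∞ (uncurry fld)
        (s, e.coord x) :=
      hfld.contMDiffAt (hopen.mem_nhds ⟨hs, show R s < ‖e.coord x‖ by linarith⟩)
    have hsm := e.contMDiffAt_outerField_family (IP := 𝓘(ℝ, ℝ)) (c := fld) hxU hc
    refine hsm.congr_of_eventuallyEq ?_
    have hev : ∀ᶠ q : ℝ × X in 𝓝 (s, x), q.1 ∈ N ∧ q.2 ∈ e.far (45 / 32 * R s) :=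
      prod_mem_nhds (hNopen.mem_nhds hsN) ((e.isOpen_far _).mem_nhds hxfar)
    filter_upwards [hev] with q hq
    have hq1 : sstar < q.1 := hq.1.2
    have hql := abs_lt.1 (hNl q.1 hq.1)
    have hq2 : q.2 ∈ e.far (5 / 4 * R q.1) := e.far_mono (by linarith [hql.2]) hq.2
    rw [hfar q hq1 hq2]
  · -- inside: the fixed section `secD` on `N × (closedFar (3 R s / 2))ᶜ`
    have hρ'R : e.R < 3 / 2 * R s := by linarith
    have hDat : ContMDiffAt (𝓘(ℝ, ℝ).prod (𝓡 3)) ((𝓡 3).prod 𝓘(ℝ, E3 →L[ℝ] E3 →L[ℝ] ℝ)) ∞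
        (fun q : ℝ × X ↦ Bundle.TotalSpace.mk' (E3 →L[ℝ] E3 →L[ℝ] ℝ)
          (E := fun x : X ↦ TangentSpace (𝓡 3) x →L[ℝ] TangentSpace (𝓡 3) x →L[ℝ] ℝ) q.2
          (secD q.2)) (s, x) :=
      (hsecD x).comp (s, x) contMDiffAt_snd
    refine hDat.congr_of_eventuallyEq ?_
    have hev : ∀ᶠ q : ℝ × X in 𝓝 (s, x), q.1 ∈ N ∧ q.2 ∉ e.closedFar (3 / 2 * R s) :=
      prod_mem_nhds (hNopen.mem_nhds hsN) ((e.isClosed_closedFar hρ'R).isOpen_compl.mem_nhds hx)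
    filter_upwards [hev] with q hq
    have hq1 : sstar < q.1 := hq.1.2
    have hql := abs_lt.1 (hNl q.1 hq.1)
    have hq2 : q.2 ∉ e.closedFar (7 / 4 * R q.1) := by
      rintro ⟨hU, hle⟩
      exact hq.2 ⟨hU, by linarith [hql.1]⟩
    rw [hin q hq1 hq2]

end Summit.FinalStateConjecture.FinalStateConjecture.Theorems.ExactKerrEnds

end
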